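import Summits.BirchSwinnertonDyer.BirchSwinnertonDyer.Theorems.Rank2Observatory2DescKill
import HarnessLib

/-!
# BirchSwinnertonDyer — rank ≥ 2 observatory: residue-insolubility kills through a common denominator (integral-basis fields)

HONEST FRAMING: per-curve certified theorems and census instruments; no claim on BSD in rank ≥ 2.

Generic addendum of the KERNEL-2DESC instrument (design `b2b-bsdr2-cert-3/KERNEL-2DESC.md` §11,
version 1.3b). The kill layer v1.3a (`Rank2Observatory2DescKill`, `not_isSquare_of_killCheck`)
removes a class of the `2`-descent cover when the `2`-covering `z·ρ² = x − θ` has no primitive point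
modulo a prime power; it is stated for `θ = t₀ + t₁α + t₂α²` and `z = z₀ + z₁α + z₂α²` with INTEGER
coordinates on the power basis of `K = ℚ(α)`. When `ℤ[α] ≠ 𝓞 K` (the integral-basis "ω" layer,
`Rank2Observatory2DescOmega`) the root `θ` of the curve cubic and the class representative `Z` (a
product of units and prime generators) are algebraic integers with `d·θ, d·Z ∈ ℤ[α]` only for a
common denominator `d ≥ 1`. Since `d²` is a square, `(x − θ)·Z` is a square in `K` iff
`(d·x − d·θ)·(d·Z)` is, and the latter is the power-basis statement at the rational point `d·x`:
* `not_isSquare_of_killCheck_dmul` — `killCheck p a b c (coords of d·Z) (coords of d·θ)₁,₂ fuel = true`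
  ⟹ `(x − θ)·Z` is not a square in `K` for any `x ∈ ℚ` (any `θ, Z ∈ K` with the two `d`-multiples in
  `ℤ[α]`; `d = 1` recovers v1.3a);
* `not_isSquare_prod_of_killCheck_dmul` — the same with `Z` written as the product over a unit set `T`
  and a generator set `U`, the shape of the hypothesis of `mordellWeilRank_le_of_coverSet_lt`.
No new residue arithmetic is needed: the certificate is searched and checked on the power basis of
the REDUCED field cubic exactly as in v1.3a.

Sorry-free; axioms `propext`, `Classical.choice`, `Quot.sound`.
[cite: Cassels1991LecturesEllipticCurves, §15] (2-coverings and local solubility)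
[cite: CremonaAlgorithms1997, §3.6] (general 2-descent) [cite: Marcus2018, Ch. 2, Thm. 9] (orders of finite index)
-/

-- single-conjunct summit: `Summit.BirchSwinnertonDyer.BirchSwinnertonDyer.…` repeats the name by design
set_option linter.dupNamespace false

noncomputable section

open scoped Classical NumberField

open Literature.NumberTheory.NumberFields Polynomial Module NumberField
open Summit.BirchSwinnertonDyer.BirchSwinnertonDyer.Rank2Observatory.TwoDescKill

namespace Summit.BirchSwinnertonDyer.BirchSwinnertonDyer.Rank2Observatory.TwoDescCubic

variable {K : Type*} [Field K] [NumberField K] {a b c : ℤ} {α : K}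

/-- **Kill soundness through a common denominator.** `K = ℚ(α)`, `α³ + aα² + bα + c = 0`, the cubic
irreducible; `Θ, Z ∈ K` with `d·Θ = m₀ + m₁α + m₂α²`, `d·Z = z₀ + z₁α + z₂α² ≠ 0` for some integer `d` (then `d ≠ 0` automatically).
If the residue search `killCheck p a b c z m₁ m₂ fuel` succeeds at a prime `p`, then `(x − Θ)·Z` is
not a square in `K` for any `x ∈ ℚ`: multiply a square root by `d` and apply
`not_isSquare_of_killCheck` at the rational point `d·x`. [cite: Cassels1991LecturesEllipticCurves, §15] -/
theorem not_isSquare_of_killCheck_dmul (hirr : Irreducible (MonicCubic.polyQ a b c))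
    (hα : aeval α (MonicCubic.poly a b c) = 0) (h3 : finrank ℚ K = 3)
    {p : ℕ} (hp : p.Prime) {z₀ z₁ z₂ : ℤ} (m₀ : ℤ) {m₁ m₂ : ℤ} {fuel : ℕ}
    (hkill : killCheck p a b c (z₀, z₁, z₂) m₁ m₂ fuel = true)
    (hz : (z₀, z₁, z₂) ≠ ((0 : ℤ), (0 : ℤ), (0 : ℤ)))
    {d : ℤ} {Θ Z : K}
    (hΘ : (d : K) * Θ = (m₀ : K) + (m₁ : K) * α + (m₂ : K) * α ^ 2)
    (hZ : (d : K) * Z = (z₀ : K) + (z₁ : K) * α + (z₂ : K) * α ^ 2) (x : ℚ) :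
    ¬ IsSquare ((algebraMap ℚ K x - Θ) * Z) := by
  rintro ⟨w, hw⟩
  refine not_isSquare_of_killCheck hirr hα h3 hp m₀ hkill hz ((d : ℚ) * x) ⟨(d : K) * w, ?_⟩
  rw [← hΘ, ← hZ, map_mul, map_intCast]
  linear_combination (d : K) ^ 2 * hw

/-- The same with the class representative written as a product: `Z = (∏_{i ∈ T} uᵢ)·(∏_{j ∈ U} Gⱼ)`
(images in `K` of units and generators of `𝓞 K`), `d·Z = z₀ + z₁α + z₂α²` checked in `K`. This is
the negation of the square-class hypothesis of `mordellWeilRank_le_of_coverSet_lt` for the pair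
`(T, U)` at every rational `x`. [cite: CremonaAlgorithms1997, §3.6] -/
theorem not_isSquare_prod_of_killCheck_dmul (hirr : Irreducible (MonicCubic.polyQ a b c))
    (hα : aeval α (MonicCubic.poly a b c) = 0) (h3 : finrank ℚ K = 3)
    {p : ℕ} (hp : p.Prime) {z₀ z₁ z₂ : ℤ} (m₀ : ℤ) {m₁ m₂ : ℤ} {fuel : ℕ}
    (hkill : killCheck p a b c (z₀, z₁, z₂) m₁ m₂ fuel = true)
    (hz : (z₀, z₁, z₂) ≠ ((0 : ℤ), (0 : ℤ), (0 : ℤ)))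
    {d : ℤ} {θ : 𝓞 K}
    (hΘ : (d : K) * algebraMap (𝓞 K) K θ = (m₀ : K) + (m₁ : K) * α + (m₂ : K) * α ^ 2)
    {m s : ℕ} {u : Fin m → (𝓞 K)ˣ} {G : Fin s → 𝓞 K} {T : Finset (Fin m)} {U : Finset (Fin s)}
    (hZ : (d : K) * ((∏ i ∈ T, algebraMap (𝓞 K) K (u i)) * ∏ j ∈ U, algebraMap (𝓞 K) K (G j)) =
      (z₀ : K) + (z₁ : K) * α + (z₂ : K) * α ^ 2) (x : ℚ) :
    ¬ IsSquare ((algebraMap ℚ K x - algebraMap (𝓞 K) K θ) *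
        (∏ i ∈ T, algebraMap (𝓞 K) K (u i)) * ∏ j ∈ U, algebraMap (𝓞 K) K (G j)) := by
  rw [mul_assoc]
  exact not_isSquare_of_killCheck_dmul hirr hα h3 hp m₀ hkill hz hΘ hZ x

/-- **Admissibility with one killed pair, ω form.** If every square class coming from a rational point
passes `adm`, and the pair `(T₀, U₀)` is killed through a common denominator as above, then every such
class passes `admKill adm T₀ U₀` — the `hadm` hypothesis of `mordellWeilRank_le_of_coverSet_lt` for the
sharpened sieve. [folklore] -/
theorem admKill_sound_dmul (hirr : Irreducible (MonicCubic.polyQ a b c))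
    (hα : aeval α (MonicCubic.poly a b c) = 0) (h3 : finrank ℚ K = 3)
    {p : ℕ} (hp : p.Prime) {z₀ z₁ z₂ : ℤ} (m₀ : ℤ) {m₁ m₂ : ℤ} {fuel : ℕ}
    (hkill : killCheck p a b c (z₀, z₁, z₂) m₁ m₂ fuel = true)
    (hz : (z₀, z₁, z₂) ≠ ((0 : ℤ), (0 : ℤ), (0 : ℤ)))
    {d : ℤ} {θ : 𝓞 K}
    (hΘ : (d : K) * algebraMap (𝓞 K) K θ = (m₀ : K) + (m₁ : K) * α + (m₂ : K) * α ^ 2)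
    {m s : ℕ} {u : Fin m → (𝓞 K)ˣ} {G : Fin s → 𝓞 K} {T₀ : Finset (Fin m)} {U₀ : Finset (Fin s)}
    (hZ : (d : K) * ((∏ i ∈ T₀, algebraMap (𝓞 K) K (u i)) * ∏ j ∈ U₀, algebraMap (𝓞 K) K (G j)) =
      (z₀ : K) + (z₁ : K) * α + (z₂ : K) * α ^ 2)
    {adm : Finset (Fin m) → Finset (Fin s) → Bool} {T : Finset (Fin m)} {U : Finset (Fin s)}
    (hadm : adm T U = true) (x : ℚ)
    (hsq : IsSquare ((algebraMap ℚ K x - algebraMap (𝓞 K) K θ) *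
        (∏ i ∈ T, algebraMap (𝓞 K) K (u i)) * ∏ j ∈ U, algebraMap (𝓞 K) K (G j))) :
    admKill adm T₀ U₀ T U = true := by
  refine admKill_of hadm ?_
  rintro ⟨rfl, rfl⟩
  exact not_isSquare_prod_of_killCheck_dmul hirr hα h3 hp m₀ hkill hz hΘ hZ x hsq

end Summit.BirchSwinnertonDyer.BirchSwinnertonDyer.Rank2Observatory.TwoDescCubic

end
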